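import Summits.CriticalPhenomena.SAWScalingLimit.Theorems.SAWDevelopingMapHexConjectureKPDefs
import Summits.CriticalPhenomena.SAWScalingLimit.Theorems.SAWDevelopingMapHexConjectureTriDlPos
import HarnessLib

/-!
# Crux `HexConjecture` (stmt-CriticalPhenomena-0808), line `root-locality-replaces-loewner`:
the analytic step of Krachun–Panagiotis — lower regularity of `triDl` turns the two-case recurrence
inequality into a LINEAR lower bound

Landing target:
`Summits/CriticalPhenomena/SAWScalingLimit/Theorems/SAWDevelopingMapHexConjectureKPAnalytic.lean`
(`--supports stmt-CriticalPhenomena-0808`; registered stub `stub_kp_analytic`).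

Write `a := HV.triDl` (positive, `stub_triDl_pos`; non-increasing, `HV.triDl_antitone`;
`triDl = triDr`, `HV.triDl_eq_triDr`).  The two constructions (a)/(b) of [KP, §3.2] give, for every
`T ≥ 1` and every pair of admissible renewal caps `M₁ ≥ renCap k` (`k ∈ [T, 2T)`), `M₂ ≥ renCap i`
(`i ∈ [4T, 5T)`), the dichotomy
`ca·T·a(2T)·a(5T) ≤ (1+M₁)·W T ∨ cb·T²·a(2T)·a(5T)·a(9T) ≤ (1+M₁)(1+M₂)·W T`
for the window mass `W`.  Under the LOWER REGULARITY hypothesis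
`REG : Σ_{i ≤ T} a i ≤ C·(T+1)·a T` (`T ≥ 1`) this file derives `∃ c > 0, ∀ T ≥ 1, c·a(9T) ≤ W T`.

The proof is elementary and uniform in `T ≥ 1` (no small-`T` case distinction):
* the RATIO LEMMA `(n+1)·a n ≤ C·(m+1)·a m` for `n ≤ m`, `1 ≤ m` (`kpAnalytic_ratio`: the first `n+1`
  terms of the sum up to `m` are each `≥ a n`), packaged as `a n ≤ q·C·a m` whenever
  `m + 1 ≤ q·(n+1)` (`kpAnalytic_le_mul`); in particular `a T ≤ 2C·a(2T)`, `a(4T) ≤ 2C·a(5T)`,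
  `a 0 ≤ 2T·C·a T`, so `1 ≤ (2C/a 0)·T·a T` absorbs the `1 +` of the caps;
* the RENEWAL SUM BOUND `Σ_{i ≤ k} a i · a ⌊(k-i-1)/2⌋ ≤ 25 C³ (k+1) (a k)²` for `k ≥ 1`, `C ≥ 1`
  (`kpAnalytic_sum_le`): termwise `a i · a j ≤ 5C·a k·(a i + a j)` (for `2i ≤ k` the second index
  `j = ⌊(k-i-1)/2⌋` has `5(j+1) ≥ k+1`, for `2i > k` the first has `5(i+1) ≥ k+1`), then REG for
  `Σ a i`, and `a ⌊(l-1)/2⌋ ≤ 4C·a l` plus the reflection `i ↦ k - i` for the second sum; hence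
  `renCap k = 8·renBound k / a k ≤ 800 C³ (k+1)·a k` (`kpAnalytic_renCap_le`, `cos(π/8) ≤ 1`);
* choose `M₁ := 800 C³·(2T)·a T`, `M₂ := 800 C³·(5T)·a(4T)`, bound `1 + M₁ ≤ K₁·T·a T`,
  `1 + M₂ ≤ K₂·T·a(4T)` and cancel: case 1 gives `ca·a(9T) ≤ 2C K₁·W T` (`kpAnalytic_case₁`),
  case 2 gives `cb·a(9T) ≤ 4C² K₁ K₂·W T` (`kpAnalytic_case₂`).
Sources: Krachun–Panagiotis, arXiv:2310.17299, §3.2 (proof of Proposition 3.1 / Corollary 3.1 from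
Lemmas 3.2–3.3); Glazman–Manolescu 2020, Lemma 4.1 (monotonicity of `D^Δ`).
-/

noncomputable section

open Finset
open Literature.Probability.RandomPlanarGeometry.SAW Literature.Probability.RandomPlanarGeometry.SAW.HV

namespace Summit.CriticalPhenomena.SAWScalingLimit.Theorems.HexConjecture.RootLocality

/-- **The ratio lemma under lower regularity**: if `Σ_{i ≤ T} a i ≤ C (T+1) a T` for all `T ≥ 1`
(`a = triDl`, non-increasing), then `(n+1)·a n ≤ C·(m+1)·a m` whenever `n ≤ m`, `1 ≤ m` — the first
`n + 1` terms of the sum up to `m` are each at least `a n`.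
[cite: KrachunPanagiotis2026, §3.2 (proof of Corollary 3.1)] -/
theorem kpAnalytic_ratio {C : ℝ}
    (hC : ∀ T : ℕ, 1 ≤ T → ∑ i ∈ range (T + 1), triDl i ≤ C * ((T : ℝ) + 1) * triDl T)
    {n m : ℕ} (hnm : n ≤ m) (hm : 1 ≤ m) :
    ((n : ℝ) + 1) * triDl n ≤ C * ((m : ℝ) + 1) * triDl m := by
  calc ((n : ℝ) + 1) * triDl n = ∑ _i ∈ range (n + 1), triDl n := by
        rw [sum_const, card_range, nsmul_eq_mul]; push_cast; ring
    _ ≤ ∑ i ∈ range (n + 1), triDl i :=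
        sum_le_sum fun i hi => triDl_antitone (by have := mem_range.1 hi; omega)
    _ ≤ ∑ i ∈ range (m + 1), triDl i :=
        sum_le_sum_of_subset_of_nonneg (range_mono (by omega)) fun i _ _ => triDl_nonneg i
    _ ≤ C * ((m : ℝ) + 1) * triDl m := hC m hm

/-- The ratio lemma in quotient-free product form: `a n ≤ q·C·a m` whenever `n ≤ m`, `1 ≤ m` and
`m + 1 ≤ q·(n + 1)`. [cite: KrachunPanagiotis2026, §3.2 (proof of Corollary 3.1)] -/
theorem kpAnalytic_le_mul {C : ℝ}
    (hC : ∀ T : ℕ, 1 ≤ T → ∑ i ∈ range (T + 1), triDl i ≤ C * ((T : ℝ) + 1) * triDl T)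
    (hC0 : 0 ≤ C) {n m : ℕ} (hnm : n ≤ m) (hm : 1 ≤ m) {q : ℝ}
    (hq : (m : ℝ) + 1 ≤ q * ((n : ℝ) + 1)) : triDl n ≤ q * C * triDl m := by
  have h0 : (0 : ℝ) < (n : ℝ) + 1 := by positivity
  refine le_of_mul_le_mul_left ?_ h0
  calc ((n : ℝ) + 1) * triDl n ≤ C * ((m : ℝ) + 1) * triDl m := kpAnalytic_ratio hC hnm hm
    _ ≤ C * (q * ((n : ℝ) + 1)) * triDl m :=
      mul_le_mul_of_nonneg_right (mul_le_mul_of_nonneg_left hq hC0) (triDl_nonneg m)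
    _ = ((n : ℝ) + 1) * (q * C * triDl m) := by ring

/-- The renewal bound with its constant pulled out:
`renBound k = 4cos(π/8) · Σ_{i ≤ k} a i · a ⌊(k-i-1)/2⌋`. [cite: KrachunPanagiotis2026, Lemma 3.1] -/
theorem kpAnalytic_renBound_eq (k : ℕ) :
    renBound k = 4 * Real.cos (Real.pi / 8) *
      ∑ i ∈ range (k + 1), triDl i * triDl ((k - i - 1) / 2) := by
  rw [renBound, mul_sum]
  exact sum_congr rfl fun i _ => by ring

/-- **The renewal sum under lower regularity**: for `C ≥ 1` satisfying REG and `k ≥ 1`,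
`Σ_{i ≤ k} a i · a ⌊(k-i-1)/2⌋ ≤ 25 C³ (k+1) (a k)²`.  Termwise `a i · a j ≤ 5C·a k·(a i + a j)`
(one of the two indices is comparable to `k`), then REG for `Σ a i`, and `a ⌊(l-1)/2⌋ ≤ 4C·a l`
with the reflection `i ↦ k - i` for `Σ a ⌊(k-i-1)/2⌋`.
[cite: KrachunPanagiotis2026, §3.2 (proof of Corollary 3.1)] -/
theorem kpAnalytic_sum_le {C : ℝ}
    (hC : ∀ T : ℕ, 1 ≤ T → ∑ i ∈ range (T + 1), triDl i ≤ C * ((T : ℝ) + 1) * triDl T)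
    (hC1 : 1 ≤ C) {k : ℕ} (hk : 1 ≤ k) :
    ∑ i ∈ range (k + 1), triDl i * triDl ((k - i - 1) / 2) ≤
      25 * C ^ 3 * ((k : ℝ) + 1) * triDl k ^ 2 := by
  have hC0 : 0 ≤ C := zero_le_one.trans hC1
  have hak := triDl_nonneg k
  have h5 : 0 ≤ 5 * C * triDl k := by positivity
  -- termwise: one of the two factors is at most `5C · a k`
  have hterm : ∀ i ∈ range (k + 1), triDl i * triDl ((k - i - 1) / 2) ≤
      5 * C * triDl k * (triDl i + triDl ((k - i - 1) / 2)) := by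
    intro i hi
    have hik : i ≤ k := Nat.lt_succ_iff.1 (mem_range.1 hi)
    have hai := triDl_nonneg i
    have haj := triDl_nonneg ((k - i - 1) / 2)
    rcases Nat.lt_or_ge k (2 * i) with h2 | h2
    · -- the first index has `5 (i + 1) ≥ k + 1`
      have hb : triDl i ≤ 5 * C * triDl k :=
        kpAnalytic_le_mul hC hC0 hik hk (by exact_mod_cast (show k + 1 ≤ 5 * (i + 1) by omega))
      calc triDl i * triDl ((k - i - 1) / 2) ≤ 5 * C * triDl k * triDl ((k - i - 1) / 2) :=
            mul_le_mul_of_nonneg_right hb haj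
        _ ≤ 5 * C * triDl k * (triDl i + triDl ((k - i - 1) / 2)) :=
            mul_le_mul_of_nonneg_left (le_add_of_nonneg_left hai) h5
    · -- the second index `j = ⌊(k-i-1)/2⌋` has `5 (j + 1) ≥ k + 1`
      have hb : triDl ((k - i - 1) / 2) ≤ 5 * C * triDl k :=
        kpAnalytic_le_mul hC hC0 (by omega) hk
          (by exact_mod_cast (show k + 1 ≤ 5 * ((k - i - 1) / 2 + 1) by omega))
      calc triDl i * triDl ((k - i - 1) / 2) ≤ triDl i * (5 * C * triDl k) :=
            mul_le_mul_of_nonneg_left hb hai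
        _ = 5 * C * triDl k * triDl i := mul_comm _ _
        _ ≤ 5 * C * triDl k * (triDl i + triDl ((k - i - 1) / 2)) :=
            mul_le_mul_of_nonneg_left (le_add_of_nonneg_right haj) h5
  -- the reflected terms: `a ⌊(k-i-1)/2⌋ ≤ 4C · a (k - i)`
  have hrefl : ∀ i ∈ range (k + 1), triDl ((k - i - 1) / 2) ≤ 4 * C * triDl (k - i) := by
    intro i _
    rcases Nat.eq_zero_or_pos (k - i) with h0 | hpos
    · have e : (k - i - 1) / 2 = 0 := by omega
      rw [e, h0]
      exact le_mul_of_one_le_left (triDl_nonneg 0) (by linarith)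
    · exact kpAnalytic_le_mul hC hC0 (by omega) (by omega)
        (by exact_mod_cast (show k - i + 1 ≤ 4 * ((k - i - 1) / 2 + 1) by omega))
  have hre : ∑ i ∈ range (k + 1), triDl (k - i) = ∑ i ∈ range (k + 1), triDl i := by
    rw [← sum_range_reflect triDl (k + 1)]
    exact sum_congr rfl fun i _ => congrArg triDl (by omega)
  have hsum₁ : ∑ i ∈ range (k + 1), triDl i ≤ C * ((k : ℝ) + 1) * triDl k := hC k hk
  have hsum₂ : ∑ i ∈ range (k + 1), triDl ((k - i - 1) / 2) ≤
      4 * C * (C * ((k : ℝ) + 1) * triDl k) := by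
    calc ∑ i ∈ range (k + 1), triDl ((k - i - 1) / 2)
        ≤ ∑ i ∈ range (k + 1), 4 * C * triDl (k - i) := sum_le_sum hrefl
      _ = 4 * C * ∑ i ∈ range (k + 1), triDl i := by rw [← mul_sum, hre]
      _ ≤ 4 * C * (C * ((k : ℝ) + 1) * triDl k) :=
        mul_le_mul_of_nonneg_left hsum₁ (by positivity)
  calc ∑ i ∈ range (k + 1), triDl i * triDl ((k - i - 1) / 2)
      ≤ ∑ i ∈ range (k + 1), 5 * C * triDl k * (triDl i + triDl ((k - i - 1) / 2)) :=
        sum_le_sum hterm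
    _ = 5 * C * triDl k * (∑ i ∈ range (k + 1), triDl i +
          ∑ i ∈ range (k + 1), triDl ((k - i - 1) / 2)) := by
        rw [← sum_add_distrib, mul_sum]
    _ ≤ 5 * C * triDl k * (C * ((k : ℝ) + 1) * triDl k + 4 * C * (C * ((k : ℝ) + 1) * triDl k)) :=
        mul_le_mul_of_nonneg_left (add_le_add hsum₁ hsum₂) h5
    _ = (5 * C ^ 2 + 20 * C ^ 3) * (((k : ℝ) + 1) * triDl k ^ 2) := by ring
    _ ≤ 25 * C ^ 3 * (((k : ℝ) + 1) * triDl k ^ 2) :=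
        mul_le_mul_of_nonneg_right
          (by nlinarith [mul_nonneg (mul_nonneg hC0 hC0) (sub_nonneg.2 hC1)]) (by positivity)
    _ = 25 * C ^ 3 * ((k : ℝ) + 1) * triDl k ^ 2 := by ring

/-- **KP's renewal cap under lower regularity**: `renCap k = 8·renBound k / triDr k ≤ 800 C³ (k+1)·a k`
for `k ≥ 1`, `C ≥ 1` (`triDr = triDl`, `cos(π/8) ≤ 1`, `kpAnalytic_sum_le`).
[cite: KrachunPanagiotis2026, §3.2 (M_k and the proof of Corollary 3.1)] -/
theorem kpAnalytic_renCap_le {C : ℝ}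
    (hC : ∀ T : ℕ, 1 ≤ T → ∑ i ∈ range (T + 1), triDl i ≤ C * ((T : ℝ) + 1) * triDl T)
    (hC1 : 1 ≤ C) {k : ℕ} (hk : 1 ≤ k) :
    renCap k ≤ 800 * C ^ 3 * ((k : ℝ) + 1) * triDl k := by
  have hS := kpAnalytic_sum_le hC hC1 hk
  have hS0 : 0 ≤ ∑ i ∈ range (k + 1), triDl i * triDl ((k - i - 1) / 2) :=
    sum_nonneg fun i _ => mul_nonneg (triDl_nonneg _) (triDl_nonneg _)
  have hcos1 : Real.cos (Real.pi / 8) ≤ 1 := Real.cos_le_one _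
  rw [renCap, ← triDl_eq_triDr, div_le_iff₀ (stub_triDl_pos k), kpAnalytic_renBound_eq]
  nlinarith [triDl_nonneg k, mul_nonneg (sub_nonneg.2 hcos1) hS0]

/-- The renewal cap on a window: for `1 ≤ S ≤ k` and `k + 1 ≤ q`, `renCap k ≤ 800 C³·q·a S`
(monotonicity of `a`). [cite: KrachunPanagiotis2026, §3.2 (M_k)] -/
theorem kpAnalytic_renCap_le' {C : ℝ}
    (hC : ∀ T : ℕ, 1 ≤ T → ∑ i ∈ range (T + 1), triDl i ≤ C * ((T : ℝ) + 1) * triDl T)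
    (hC1 : 1 ≤ C) {S k q : ℕ} (hS : 1 ≤ S) (hSk : S ≤ k) (hkq : k + 1 ≤ q) :
    renCap k ≤ 800 * C ^ 3 * (q : ℝ) * triDl S := by
  have hC0 : 0 ≤ C := zero_le_one.trans hC1
  have e1 : (k : ℝ) + 1 ≤ q := by exact_mod_cast hkq
  calc renCap k ≤ 800 * C ^ 3 * ((k : ℝ) + 1) * triDl k :=
        kpAnalytic_renCap_le hC hC1 (hS.trans hSk)
    _ ≤ 800 * C ^ 3 * (q : ℝ) * triDl S :=
        mul_le_mul (mul_le_mul_of_nonneg_left e1 (by positivity)) (triDl_antitone hSk)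
          (triDl_nonneg k) (by positivity)

/-- The algebra of case (a): from `ca·t·a₂·a₅ ≤ (1+M)·w`, `1 + M ≤ K·t·aT`, `aT ≤ 2C·a₂` and
`a₉ ≤ a₅`, cancelling `t·a₂ > 0` gives `ca·a₉ ≤ 2CK·w`. [cite: KrachunPanagiotis2026, §3.2 (proof of Proposition 3.1, case (a))] -/
theorem kpAnalytic_case₁ {ca C K t aT a₂ a₅ a₉ w M : ℝ} (ht : 0 < t) (ha₂ : 0 < a₂)
    (h₅₉ : a₉ ≤ a₅) (hw : 0 ≤ w) (hK : 0 ≤ K * t) (hca : 0 ≤ ca) (hr : aT ≤ 2 * C * a₂)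
    (hone : 1 + M ≤ K * t * aT) (h : ca * t * a₂ * a₅ ≤ (1 + M) * w) :
    ca * a₉ ≤ 2 * C * K * w := by
  have key : (t * a₂) * (ca * a₉) ≤ (t * a₂) * (2 * C * K * w) := by
    calc (t * a₂) * (ca * a₉) = ca * t * a₂ * a₉ := by ring
      _ ≤ ca * t * a₂ * a₅ := mul_le_mul_of_nonneg_left h₅₉ (by positivity)
      _ ≤ (1 + M) * w := h
      _ ≤ K * t * aT * w := mul_le_mul_of_nonneg_right hone hw
      _ ≤ K * t * (2 * C * a₂) * w :=
        mul_le_mul_of_nonneg_right (mul_le_mul_of_nonneg_left hr hK) hw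
      _ = (t * a₂) * (2 * C * K * w) := by ring
  exact le_of_mul_le_mul_left key (mul_pos ht ha₂)

/-- The algebra of case (b): from `cb·t²·a₂·a₅·a₉ ≤ (1+M₁)(1+M₂)·w`, `1 + M₁ ≤ K₁·t·aT`,
`1 + M₂ ≤ K₂·t·a₄`, `aT ≤ 2C·a₂`, `a₄ ≤ 2C·a₅`, cancelling `t²·a₂·a₅ > 0` gives
`cb·a₉ ≤ 4C²K₁K₂·w`. [cite: KrachunPanagiotis2026, §3.2 (proof of Proposition 3.1, case (b))] -/
theorem kpAnalytic_case₂ {cb C K₁ K₂ t aT a₄ a₂ a₅ a₉ w M₁ M₂ : ℝ} (ht : 0 < t) (ha₂ : 0 < a₂)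
    (ha₅ : 0 < a₅) (hw : 0 ≤ w) (hK₁ : 0 ≤ K₁ * t) (hK₂ : 0 ≤ K₂ * t) (hM₂ : 0 ≤ 1 + M₂)
    (haT : 0 ≤ aT) (ha₄ : 0 ≤ a₄) (hC : 0 ≤ C) (hr₂ : aT ≤ 2 * C * a₂)
    (hr₅ : a₄ ≤ 2 * C * a₅) (hone₁ : 1 + M₁ ≤ K₁ * t * aT) (hone₂ : 1 + M₂ ≤ K₂ * t * a₄)
    (h : cb * t ^ 2 * a₂ * a₅ * a₉ ≤ (1 + M₁) * (1 + M₂) * w) :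
    cb * a₉ ≤ 4 * C ^ 2 * K₁ * K₂ * w := by
  have key : (t ^ 2 * a₂ * a₅) * (cb * a₉) ≤ (t ^ 2 * a₂ * a₅) * (4 * C ^ 2 * K₁ * K₂ * w) := by
    calc (t ^ 2 * a₂ * a₅) * (cb * a₉) = cb * t ^ 2 * a₂ * a₅ * a₉ := by ring
      _ ≤ (1 + M₁) * (1 + M₂) * w := h
      _ ≤ (K₁ * t * aT) * (K₂ * t * a₄) * w :=
        mul_le_mul_of_nonneg_right (mul_le_mul hone₁ hone₂ hM₂ (mul_nonneg hK₁ haT)) hw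
      _ ≤ (K₁ * t * (2 * C * a₂)) * (K₂ * t * (2 * C * a₅)) * w :=
        mul_le_mul_of_nonneg_right
          (mul_le_mul (mul_le_mul_of_nonneg_left hr₂ hK₁) (mul_le_mul_of_nonneg_left hr₅ hK₂)
            (mul_nonneg hK₂ ha₄) (mul_nonneg hK₁ (by positivity))) hw
      _ = (t ^ 2 * a₂ * a₅) * (4 * C ^ 2 * K₁ * K₂ * w) := by ring
  exact le_of_mul_le_mul_left key (by positivity)

/-- `min c₁ c₂ · x ≤ w` as soon as one of `c₁ x ≤ w`, `c₂ x ≤ w` holds (`x ≥ 0`). [folklore] -/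
theorem kpAnalytic_min_mul_le {c₁ c₂ x w : ℝ} (hx : 0 ≤ x) (h : c₁ * x ≤ w ∨ c₂ * x ≤ w) :
    min c₁ c₂ * x ≤ w := by
  rcases h with h | h
  · exact (mul_le_mul_of_nonneg_right (min_le_left _ _) hx).trans h
  · exact (mul_le_mul_of_nonneg_right (min_le_right _ _) hx).trans h

/-- **Registered sub-goal `stub_kp_analytic`** (crux item stmt-CriticalPhenomena-0808, line
`root-locality-replaces-loewner`): the analytic step of Krachun–Panagiotis.  From the lower regularity
`Σ_{i ≤ T} triDl i ≤ C (T+1) triDl T` of the Glazman–Manolescu triangle tail and the two-case recurrence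
inequality of constructions (a)/(b) (valid for all admissible renewal caps `M₁` on `[T, 2T)` and `M₂`
on `[4T, 5T)`), the window mass `W T` dominates `triDl (9T)` LINEARLY: `∃ c > 0, ∀ T ≥ 1,
c·triDl(9T) ≤ W T`.  Proof: WLOG `C ≥ 1`; choose the caps `M₁ = 800C³·(2T)·triDl T`,
`M₂ = 800C³·(5T)·triDl(4T)` (`kpAnalytic_renCap_le'`), absorb `1 +` by `triDl 0 ≤ 2T·C·triDl T`,
`triDl 0 ≤ 5T·C·triDl(4T)` and cancel with `triDl T ≤ 2C·triDl(2T)`, `triDl(4T) ≤ 2C·triDl(5T)`,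
`triDl(9T) ≤ triDl(5T)`; `c = min (ca/(2CK₁)) (cb/(4C²K₁K₂))` with `K₁ = 2C/triDl 0 + 1600C³`,
`K₂ = 5C/triDl 0 + 4000C³`.
[cite: KrachunPanagiotis2026, §3.2 (Corollary 3.1 and its proof from Lemmas 3.2–3.3)] -/
theorem stub_kp_analytic : (∃ C : ℝ, ∀ T : ℕ, 1 ≤ T → ∑ i ∈ Finset.range (T + 1), Literature.Probability.RandomPlanarGeometry.SAW.HV.triDl i ≤ C * ((T : ℝ) + 1) * Literature.Probability.RandomPlanarGeometry.SAW.HV.triDl T) → ∀ (ca cb : ℝ), 0 < ca → 0 < cb → ∀ (W : ℕ → ℝ), (∀ T : ℕ, 1 ≤ T → ∀ M₁ M₂ : ℝ, (∀ k : ℕ, T ≤ k → k < 2 * T → renCap k ≤ M₁) → (∀ i : ℕ, 4 * T ≤ i → i < 5 * T → renCap i ≤ M₂) → ca * (T : ℝ) * Literature.Probability.RandomPlanarGeometry.SAW.HV.triDl (2 * T) * Literature.Probability.RandomPlanarGeometry.SAW.HV.triDl (5 * T) ≤ (1 + M₁) * W T ∨ cb * (T : ℝ) ^ 2 * Literature.Probability.RandomPlanarGeometry.SAW.HV.triDl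 (2 * T) * Literature.Probability.RandomPlanarGeometry.SAW.HV.triDl (5 * T) * Literature.Probability.RandomPlanarGeometry.SAW.HV.triDl (9 * T) ≤ (1 + M₁) * (1 + M₂) * W T) → ∃ c : ℝ, 0 < c ∧ ∀ T : ℕ, 1 ≤ T → c * Literature.Probability.RandomPlanarGeometry.SAW.HV.triDl (9 * T) ≤ W T := by
  rintro ⟨C₀, hC₀⟩ ca cb hca hcb W hW
  -- WLOG the regularity constant is at least `1`
  obtain ⟨C, hC1, hC⟩ : ∃ C : ℝ, 1 ≤ C ∧
      ∀ T : ℕ, 1 ≤ T → ∑ i ∈ range (T + 1), triDl i ≤ C * ((T : ℝ) + 1) * triDl T := by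
    refine ⟨max C₀ 1, le_max_right _ _, fun T hT => (hC₀ T hT).trans ?_⟩
    rw [mul_assoc, mul_assoc]
    exact mul_le_mul_of_nonneg_right (le_max_left _ _)
      (mul_nonneg (by positivity) (triDl_nonneg T))
  have hC0 : 0 < C := one_pos.trans_le hC1
  have ha0 : 0 < triDl 0 := stub_triDl_pos 0
  -- the constants absorbing `1 + M₁`, `1 + M₂`
  obtain ⟨K₁, hK₁0, hK₁⟩ : ∃ K₁ : ℝ, 0 < K₁ ∧ K₁ = 2 * C / triDl 0 + 1600 * C ^ 3 :=
    ⟨_, by positivity, rfl⟩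
  obtain ⟨K₂, hK₂0, hK₂⟩ : ∃ K₂ : ℝ, 0 < K₂ ∧ K₂ = 5 * C / triDl 0 + 4000 * C ^ 3 :=
    ⟨_, by positivity, rfl⟩
  refine ⟨min (ca / (2 * C * K₁)) (cb / (4 * C ^ 2 * K₁ * K₂)),
    lt_min (by positivity) (by positivity), fun T hT => ?_⟩
  have hT0 : (0 : ℝ) < T := by exact_mod_cast hT
  have h2 := stub_triDl_pos (2 * T)
  have h5 := stub_triDl_pos (5 * T)
  -- the caps `M₁ = 800C³·(2T)·a T`, `M₂ = 800C³·(5T)·a(4T)` are admissible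
  have hcap₁ : ∀ k : ℕ, T ≤ k → k < 2 * T →
      renCap k ≤ 800 * C ^ 3 * ((2 * T : ℕ) : ℝ) * triDl T :=
    fun k hk1 hk2 => kpAnalytic_renCap_le' hC hC1 hT hk1 (by omega)
  have hcap₂ : ∀ i : ℕ, 4 * T ≤ i → i < 5 * T →
      renCap i ≤ 800 * C ^ 3 * ((5 * T : ℕ) : ℝ) * triDl (4 * T) :=
    fun i hi1 hi2 => kpAnalytic_renCap_le' hC hC1 (by omega) hi1 (by omega)
  have hM₁ : (0 : ℝ) ≤ 1 + 800 * C ^ 3 * ((2 * T : ℕ) : ℝ) * triDl T :=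
    add_nonneg zero_le_one (mul_nonneg (by positivity) (triDl_nonneg T))
  have hM₂ : (0 : ℝ) ≤ 1 + 800 * C ^ 3 * ((5 * T : ℕ) : ℝ) * triDl (4 * T) :=
    add_nonneg zero_le_one (mul_nonneg (by positivity) (triDl_nonneg (4 * T)))
  -- absorbing the `1 +`: `a 0 ≤ 2T·C·a T`, `a 0 ≤ 5T·C·a(4T)`
  have e₁ : triDl 0 ≤ 2 * T * C * triDl T :=
    kpAnalytic_le_mul hC hC0.le (Nat.zero_le T) hT
      (by simpa using (show (T : ℝ) + 1 ≤ 2 * T by exact_mod_cast (show T + 1 ≤ 2 * T by omega)))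
  have e₂ : triDl 0 ≤ 5 * T * C * triDl (4 * T) :=
    kpAnalytic_le_mul hC hC0.le (Nat.zero_le (4 * T)) (by omega)
      (by simpa using (show ((4 * T : ℕ) : ℝ) + 1 ≤ 5 * T by
        exact_mod_cast (show 4 * T + 1 ≤ 5 * T by omega)))
  have hone₁ : 1 + 800 * C ^ 3 * ((2 * T : ℕ) : ℝ) * triDl T ≤ K₁ * T * triDl T := by
    have e : (1 : ℝ) ≤ 2 * T * C * triDl T / triDl 0 := by
      rw [le_div_iff₀ ha0, one_mul]; exact e₁
    have e' : K₁ * T * triDl T =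
        2 * T * C * triDl T / triDl 0 + 800 * C ^ 3 * ((2 * T : ℕ) : ℝ) * triDl T := by
      rw [hK₁]; push_cast; ring
    rw [e']
    exact add_le_add e le_rfl
  have hone₂ : 1 + 800 * C ^ 3 * ((5 * T : ℕ) : ℝ) * triDl (4 * T) ≤ K₂ * T * triDl (4 * T) := by
    have e : (1 : ℝ) ≤ 5 * T * C * triDl (4 * T) / triDl 0 := by
      rw [le_div_iff₀ ha0, one_mul]; exact e₂
    have e' : K₂ * T * triDl (4 * T) =
        5 * T * C * triDl (4 * T) / triDl 0 + 800 * C ^ 3 * ((5 * T : ℕ) : ℝ) * triDl (4 * T) := by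
      rw [hK₂]; push_cast; ring
    rw [e']
    exact add_le_add e le_rfl
  -- ratio facts at the scales `T, 2T` and `4T, 5T`, and monotonicity `9T ≥ 5T`
  have r₂ : triDl T ≤ 2 * C * triDl (2 * T) :=
    kpAnalytic_le_mul hC hC0.le (by omega) (by omega)
      (by exact_mod_cast (show 2 * T + 1 ≤ 2 * (T + 1) by omega))
  have r₅ : triDl (4 * T) ≤ 2 * C * triDl (5 * T) :=
    kpAnalytic_le_mul hC hC0.le (by omega) (by omega)
      (by exact_mod_cast (show 5 * T + 1 ≤ 2 * (4 * T + 1) by omega))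
  have m59 : triDl (9 * T) ≤ triDl (5 * T) := triDl_antitone (by omega)
  -- the dichotomy with the chosen caps; in either case `W T > 0`
  have hWT := hW T hT _ _ hcap₁ hcap₂
  have hWpos : 0 < W T := by
    rcases hWT with h | h
    · exact pos_of_mul_pos_right ((mul_pos (mul_pos (mul_pos hca hT0) h2) h5).trans_le h) hM₁
    · exact pos_of_mul_pos_right
        ((mul_pos (mul_pos (mul_pos (mul_pos hcb (by positivity)) h2) h5)
          (stub_triDl_pos _)).trans_le h) (mul_nonneg hM₁ hM₂)
  refine kpAnalytic_min_mul_le (triDl_nonneg _) (hWT.imp (fun h => ?_) (fun h => ?_))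
  · -- case (a): `ca · a(9T) ≤ 2 C K₁ · W T`
    have key := kpAnalytic_case₁ hT0 h2 m59 hWpos.le (by positivity) hca.le r₂ hone₁ h
    rw [div_mul_eq_mul_div, div_le_iff₀ (by positivity)]
    exact key.trans_eq (by ring)
  · -- case (b): `cb · a(9T) ≤ 4 C² K₁ K₂ · W T`
    have key := kpAnalytic_case₂ hT0 h2 h5 hWpos.le (by positivity) (by positivity) hM₂
      (triDl_nonneg T) (triDl_nonneg (4 * T)) hC0.le r₂ r₅ hone₁ hone₂ h
    rw [div_mul_eq_mul_div, div_le_iff₀ (by positivity)]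
    exact key.trans_eq (by ring)

end Summit.CriticalPhenomena.SAWScalingLimit.Theorems.HexConjecture.RootLocality

end
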